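import Summits.Parity.GeneralizedHardyLittlewood.Theorems.BeyondDiagonalBeatsQuarter.PeterssonSplitDiagOff
import Summits.Parity.GeneralizedHardyLittlewood.Theorems.BeyondDiagonalBeatsQuarter.CornerWeightAFEBridge
import HarnessLib

/-!
# Route `PrimeLevelFamEdge`, crux K_B (stmt-Parity-20343), line `diagonal_kernel_split`, helper H4
# (exact Petersson/AFE split), part (d2): ONE diagonal line — for fixed `d₁ ∣ a`, `d₂ ∣ b` the
# `δ`-solutions `(n₁, n₂)` of `a n₁/d₁² = b n₂/d₂²`, `d₁ ∣ n₁`, `d₂ ∣ n₂`, form the line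
# `t ↦ (d₁(b/d₂)/c · t, d₂(a/d₁)/c · t)`, `c = gcd(a/d₁, b/d₂)`, and the AFE weight summed along it is
# `c·(ab)^{−1/2}·𝒲((a/c)(b/c)/q̂²)` (`𝒲 = Corner.scriptW`, via the D1 bridge `scriptW_eq_tsum_cutoffW`)

[KowalskiMichelVanderKam2000] (21)–(23) p. 12–13: this is the bookkeeping that turns the Petersson diagonal of
the AFE ⊗ Hecke expansion into the TRUE diagonal kernel of helper H1. Helper; closes nothing; theorems only.
«The programme SEARCHES and TYPES; no claim about Landau–Siegel zeros, Theorems 1–2 of arXiv:2211.02515 or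
a repaired Margin232 until a kernel theorem says so.»
-/

noncomputable section

open Finset
open scoped Real

namespace Summit.Parity.GeneralizedHardyLittlewood.Theorems.BeyondDiagonalBeatsQuarter.PeterssonSplit

open Literature.NumberTheory.LFunctions Literature.NumberTheory.LFunctions.KMV2000

/-! ### Arithmetic of one diagonal line -/

section Line

variable {a b d₁ d₂ : ℕ}

/-- Exactness: `a·(d₁k)/d₁² = (a/d₁)·k` for `d₁ ∣ a`, `d₁ ≠ 0`. [folklore] -/
theorem mul_mul_div_sq {a d k : ℕ} (hd : d ∣ a) (hd0 : d ≠ 0) :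
    a * (d * k) / d ^ 2 = a / d * k := by
  obtain ⟨a', rfl⟩ := hd
  rw [Nat.mul_div_cancel_left _ (Nat.pos_of_ne_zero hd0), sq,
    show d * a' * (d * k) = d * d * (a' * k) by ring,
    Nat.mul_div_cancel_left _ (by positivity)]

/-- **The line solves the diagonal condition.** With `c = gcd(a/d₁, b/d₂)`, `e₁ = (b/d₂)/c`, `e₂ = (a/d₁)/c`:
`a·(d₁e₁t)/d₁² = b·(d₂e₂t)/d₂²` (both `= (a/d₁)(b/d₂)t/c`). [folklore] -/
theorem line_cond (hd₁ : d₁ ∣ a) (hd₂ : d₂ ∣ b) (hd₁0 : d₁ ≠ 0) (hd₂0 : d₂ ≠ 0) (t : ℕ) :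
    a * (d₁ * ((b / d₂ / (a / d₁).gcd (b / d₂)) * t)) / d₁ ^ 2 =
      b * (d₂ * ((a / d₁ / (a / d₁).gcd (b / d₂)) * t)) / d₂ ^ 2 := by
  rw [mul_mul_div_sq hd₁ hd₁0, mul_mul_div_sq hd₂ hd₂0, ← mul_assoc, ← mul_assoc,
    ← Nat.mul_div_assoc _ (Nat.gcd_dvd_right _ _), ← Nat.mul_div_assoc _ (Nat.gcd_dvd_left _ _),
    mul_comm (a / d₁) (b / d₂)]

/-- **Completeness of the line.** If `d₁ ∣ n₁`, `d₂ ∣ n₂` and `a n₁/d₁² = b n₂/d₂²` (`d₁ ∣ a`, `d₂ ∣ b`,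
`a, b ≠ 0`), then `(n₁, n₂)` lies on the line: `n₁ = d₁e₁t`, `n₂ = d₂e₂t` for some `t`
(`a₁b₁ = a₂b₂ ⇒ lcm(a₁,a₂) ∣ a₁b₁`). [folklore] -/
theorem line_complete (hd₁ : d₁ ∣ a) (hd₂ : d₂ ∣ b) (ha : a ≠ 0) (hb : b ≠ 0) {n₁ n₂ : ℕ}
    (h₁ : d₁ ∣ n₁) (h₂ : d₂ ∣ n₂) (heq : a * n₁ / d₁ ^ 2 = b * n₂ / d₂ ^ 2) :
    ∃ t : ℕ, n₁ = d₁ * ((b / d₂ / (a / d₁).gcd (b / d₂)) * t) ∧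
      n₂ = d₂ * ((a / d₁ / (a / d₁).gcd (b / d₂)) * t) := by
  have hd₁0 : d₁ ≠ 0 := fun h ↦ ha (Nat.eq_zero_of_zero_dvd (h ▸ hd₁))
  have hd₂0 : d₂ ≠ 0 := fun h ↦ hb (Nat.eq_zero_of_zero_dvd (h ▸ hd₂))
  obtain ⟨b₁, rfl⟩ := h₁
  obtain ⟨b₂, rfl⟩ := h₂
  rw [mul_mul_div_sq hd₁ hd₁0, mul_mul_div_sq hd₂ hd₂0] at heq
  set a₁ := a / d₁ with ha₁
  set a₂ := b / d₂ with ha₂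
  have ha₁0 : a₁ ≠ 0 := fun h ↦ ha (Nat.eq_zero_of_dvd_of_div_eq_zero hd₁ h)
  have ha₂0 : a₂ ≠ 0 := fun h ↦ hb (Nat.eq_zero_of_dvd_of_div_eq_zero hd₂ h)
  set c := a₁.gcd a₂ with hc
  have hc0 : 0 < c := Nat.gcd_pos_of_pos_left _ (Nat.pos_of_ne_zero ha₁0)
  -- lcm(a₁,a₂) ∣ ℓ := a₁ b₁ = a₂ b₂
  have hl : a₁.lcm a₂ ∣ a₁ * b₁ := Nat.lcm_dvd (Dvd.intro _ rfl) (heq ▸ Dvd.intro _ rfl)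
  obtain ⟨t, ht⟩ := hl
  refine ⟨t, ?_, ?_⟩
  · -- b₁ = (a₂/c) t  since a₁ b₁ = lcm · t = a₁ (a₂/c) t
    have h1 : a₁ * b₁ = a₁ * (a₂ / c * t) := by
      rw [ht, Nat.lcm, ← hc, ← mul_assoc, Nat.mul_div_assoc _ (Nat.gcd_dvd_right _ _)]
    rw [Nat.eq_of_mul_eq_mul_left (Nat.pos_of_ne_zero ha₁0) h1]
  · have h1 : a₂ * b₂ = a₂ * (a₁ / c * t) := by
      rw [← heq, ht, Nat.lcm, ← hc, ← mul_assoc, mul_comm a₁ a₂,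
        Nat.mul_div_assoc _ (Nat.gcd_dvd_left _ _)]
    rw [Nat.eq_of_mul_eq_mul_left (Nat.pos_of_ne_zero ha₂0) h1]

/-- The product along the line: `(d₁e₁t)(d₂e₂t) = ((a/c)(b/c))·t²`. [folklore] -/
theorem line_prod (hd₁ : d₁ ∣ a) (hd₂ : d₂ ∣ b) (t : ℕ) :
    d₁ * ((b / d₂ / (a / d₁).gcd (b / d₂)) * t) * (d₂ * ((a / d₁ / (a / d₁).gcd (b / d₂)) * t)) =
      (a / (a / d₁).gcd (b / d₂)) * (b / (a / d₁).gcd (b / d₂)) * t ^ 2 := by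
  set c := (a / d₁).gcd (b / d₂) with hc
  have h1 : d₁ * (a / d₁ / c) = a / c := by
    rw [← Nat.mul_div_assoc _ (Nat.gcd_dvd_left _ _), Nat.mul_div_cancel' hd₁]
  have h2 : d₂ * (b / d₂ / c) = b / c := by
    rw [← Nat.mul_div_assoc _ (Nat.gcd_dvd_right _ _), Nat.mul_div_cancel' hd₂]
  calc d₁ * ((b / d₂ / c) * t) * (d₂ * ((a / d₁ / c) * t))
      = (d₁ * (a / d₁ / c)) * (d₂ * (b / d₂ / c)) * t ^ 2 := by ring
    _ = (a / c) * (b / c) * t ^ 2 := by rw [h1, h2]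

end Line

/-! ### The AFE weight along one line -/

variable {q : ℕ}

/-- **The AFE weight summed along one diagonal line.** For `q ≥ 1`, `a, b ≠ 0`, `d₁ ∣ a`, `d₂ ∣ b`, with
`c = gcd(a/d₁, b/d₂)`:
`Σ_{(n₁,n₂)} 𝟙[d₁∣n₁, d₂∣n₂, a n₁/d₁² = b n₂/d₂²]·w_q(n₁,n₂) = c·(ab)^{−1/2}·𝒲(((a/c)(b/c))/q̂²)`.
[cite: KowalskiMichelVanderKam2000, (21)–(23) p. 12 — derivation] -/
theorem hasSum_afeWeight_line (hq : 1 ≤ q) {a b d₁ d₂ : ℕ} (ha : a ≠ 0) (hb : b ≠ 0) (hd₁ : d₁ ∣ a)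
    (hd₂ : d₂ ∣ b) :
    HasSum (fun n : ℕ × ℕ ↦ if d₁ ∣ n.1 ∧ d₂ ∣ n.2 ∧ a * n.1 / d₁ ^ 2 = b * n.2 / d₂ ^ 2
        then afeWeight q n else 0)
      (((a / d₁).gcd (b / d₂) : ℝ) * ((a : ℝ) * b) ^ (-(1 / 2 : ℝ)) *
        Corner.scriptW ((((a / (a / d₁).gcd (b / d₂)) * (b / (a / d₁).gcd (b / d₂)) : ℕ) : ℝ) /
          qhat q ^ 2)) := by
  classical
  have hd₁0 : d₁ ≠ 0 := fun h ↦ ha (Nat.eq_zero_of_zero_dvd (h ▸ hd₁))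
  have hd₂0 : d₂ ≠ 0 := fun h ↦ hb (Nat.eq_zero_of_zero_dvd (h ▸ hd₂))
  have hQ : 0 < qhat q := qhat_pos hq
  set a₁ := a / d₁ with ha₁
  set a₂ := b / d₂ with ha₂
  have ha₁0 : a₁ ≠ 0 := fun h ↦ ha (Nat.eq_zero_of_dvd_of_div_eq_zero hd₁ h)
  have ha₂0 : a₂ ≠ 0 := fun h ↦ hb (Nat.eq_zero_of_dvd_of_div_eq_zero hd₂ h)
  set c := a₁.gcd a₂ with hc
  have hc0 : c ≠ 0 := (Nat.gcd_pos_of_pos_left _ (Nat.pos_of_ne_zero ha₁0)).ne'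
  have hca : c ∣ a := (Nat.gcd_dvd_left _ _).trans (Nat.div_dvd_of_dvd hd₁)
  have hcb : c ∣ b := (Nat.gcd_dvd_right _ _).trans (Nat.div_dvd_of_dvd hd₂)
  set e₁ := a₂ / c with he₁
  set e₂ := a₁ / c with he₂
  have he₁0 : e₁ ≠ 0 := fun h ↦ ha₂0 (Nat.eq_zero_of_dvd_of_div_eq_zero (Nat.gcd_dvd_right _ _) h)
  have he₂0 : e₂ ≠ 0 := fun h ↦ ha₁0 (Nat.eq_zero_of_dvd_of_div_eq_zero (Nat.gcd_dvd_left _ _) h)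
  -- the line and its properties
  set g : ℕ → ℕ × ℕ := fun t ↦ (d₁ * (e₁ * t), d₂ * (e₂ * t)) with hg
  have hg_inj : Function.Injective g := by
    intro s t hst
    have h1 := congrArg Prod.fst hst
    simp only [hg] at h1
    have hpos : 0 < d₁ * e₁ := Nat.pos_of_ne_zero (mul_ne_zero hd₁0 he₁0)
    rw [← mul_assoc, ← mul_assoc] at h1
    exact Nat.eq_of_mul_eq_mul_left hpos h1
  set K : ℕ := (a / c) * (b / c) with hK
  have hK0 : K ≠ 0 := mul_ne_zero (fun h ↦ ha (Nat.eq_zero_of_dvd_of_div_eq_zero hca h))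
    (fun h ↦ hb (Nat.eq_zero_of_dvd_of_div_eq_zero hcb h))
  have hprod : ∀ t, (g t).1 * (g t).2 = K * t ^ 2 := fun t ↦ line_prod hd₁ hd₂ t
  -- the summand
  set f : ℕ × ℕ → ℝ := fun n ↦ if d₁ ∣ n.1 ∧ d₂ ∣ n.2 ∧ a * n.1 / d₁ ^ 2 = b * n.2 / d₂ ^ 2
    then afeWeight q n else 0 with hf
  have hf_supp : Function.support f ⊆ Set.range g := by
    intro n hn
    rw [Function.mem_support] at hn
    have hcond : d₁ ∣ n.1 ∧ d₂ ∣ n.2 ∧ a * n.1 / d₁ ^ 2 = b * n.2 / d₂ ^ 2 := by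
      by_contra hnot; exact hn (by simp only [hf, if_neg hnot])
    obtain ⟨t, h1, h2⟩ := line_complete hd₁ hd₂ ha hb hcond.1 hcond.2.1 hcond.2.2
    exact ⟨t, Prod.ext h1.symm h2.symm⟩
  have hfg : ∀ t, f (g t) = afeWeight q (g t) := by
    intro t
    simp only [hf, hg]
    rw [if_pos ⟨Dvd.intro _ rfl, Dvd.intro _ rfl, line_cond hd₁ hd₂ hd₁0 hd₂0 t⟩]
  -- summability (dominated by the full AFE weight)
  have hf_nonneg : ∀ n, 0 ≤ f n := fun n ↦ by
    simp only [hf]; split_ifs <;> [exact afeWeight_nonneg q n; exact le_rfl]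
  have hf_le : ∀ n, f n ≤ afeWeight q n := fun n ↦ by
    simp only [hf]; split_ifs <;> [exact le_rfl; exact afeWeight_nonneg q n]
  have hf_sum : Summable f := Summable.of_nonneg_of_le hf_nonneg hf_le (summable_afeWeight hq)
  have hfg_sum : Summable (f ∘ g) := hf_sum.comp_injective hg_inj
  -- the weight along the line
  set y : ℝ := (K : ℝ) / qhat q ^ 2 with hy
  have hy0 : 0 < y := by positivity
  have hKr : (K : ℝ) = (a : ℝ) * b / (c : ℝ) ^ 2 := by
    rw [hK, Nat.cast_mul, Nat.cast_div hca (by exact_mod_cast hc0), Nat.cast_div hcb (by exact_mod_cast hc0)]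
    field_simp
  have hval : ∀ l : ℕ, afeWeight q (g (l + 1)) =
      (c : ℝ) * ((a : ℝ) * b) ^ (-(1 / 2 : ℝ)) * (cutoffW ((((l : ℝ) + 1) ^ 2) * y) / ((l : ℝ) + 1)) := by
    intro l
    have hn : ((g (l + 1)).1 : ℝ) * (g (l + 1)).2 = (K : ℝ) * ((l : ℝ) + 1) ^ 2 := by
      rw [← Nat.cast_mul, hprod]; push_cast; ring
    unfold afeWeight
    rw [hn, hy, Real.mul_rpow (by positivity) (by positivity), hKr,
      Real.div_rpow (by positivity) (by positivity), ← Real.rpow_natCast ((l : ℝ) + 1) 2,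
      ← Real.rpow_mul (by positivity), ← Real.rpow_natCast (c : ℝ) 2, ← Real.rpow_mul (by positivity)]
    norm_num
    rw [Real.rpow_neg_one, Real.rpow_neg_one]
    field_simp
  have h0 : afeWeight q (g 0) = 0 := by simp [hg, afeWeight]
  -- assemble
  have hfg_sum' : Summable (fun t ↦ f (g t)) := hfg_sum
  have hsum_fg : ∑' t, f (g t) = (c : ℝ) * ((a : ℝ) * b) ^ (-(1 / 2 : ℝ)) * Corner.scriptW y := by
    rw [hfg_sum'.tsum_eq_zero_add]
    simp only [hfg, h0, zero_add, hval]
    rw [tsum_mul_left, Corner.scriptW_eq_tsum_cutoffW hy0]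
  rw [← hsum_fg, hg_inj.tsum_eq hf_supp]
  exact hf_sum.hasSum

end Summit.Parity.GeneralizedHardyLittlewood.Theorems.BeyondDiagonalBeatsQuarter.PeterssonSplit
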